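import Literature.Probability.Percolation.Percolation
import Literature.Probability.LatticeModels.IsoradialPercolation
import HarnessLib

/-!
# Crux `PercNearOneGluing.AdditiveGluing` (stmt-CriticalPhenomena-4576), line `tieline`: connectivity atoms of `k` points

Support file (`--supports stmt-CriticalPhenomena-4576`, helper, lead c11).  No named facts, no sorries.  Bookkeeping that
turns LP certificates over the "52 atoms" (set partitions of five marked vertices) into Lean proofs; general `k` and `V`.

Marked vertices `p : Fin k → V` of `BondConfig V`.  The **connectivity pattern** of `ω` is the equivalence relation
`i ~ j ⇔ p i ↔ p j in ω` on `Fin k`; a set partition of `Fin k` is encoded by its **canonical (min-)labeling**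
`π : Fin k → Fin k`, `π i =` the least element of the block of `i` (`IsCanon π ⇔ ∀ i, π (π i) = π i ∧ π i ≤ i`; unique
given the blocks, `IsCanon.eq_of_forall_iff`); `canonSet k = {π | IsCanon π}` (a `Finset`; `card_canonSet_five = 52`).
* `canonOf r` — canonical labeling of an equivalence relation `r` (`canonOf_eq_iff`, `isCanon_canonOf`);
  `label p ω = canonOf (pattern of ω)`; `atom p π = {ω | ∀ i j, p i ↔ p j ⇔ π i = π j}` = `label p ⁻¹' {π}` for
  canonical `π` (`atom_eq_preimage_label`); the atoms over `canonSet k` partition the space (`disjoint_atom`,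
  `iUnion_atom_eq_univ`).
* `HasPattern p E Φ` — on the atom of a canonical `π`, membership in `E` is `Φ π` (`⇔ E = label p ⁻¹' Φ`,
  `HasPattern.iff_eq_preimage`); closure rules `HasPattern.openConn/univ/compl/inter/union/diff/iInter/iUnion/atom/of_iff`;
  the predicate-free form `PatternDetermined p E` (`PatternDetermined.hasPattern`: `Φ π = (atom p π ⊆ E)`), same closure rules.
* **Decomposition** `measureReal_eq_sum_atoms`: for a finite measure `μ` on `BondConfig V`, `V` finite (e.g. `prodBernoulli
  w`): `HasPattern p E Φ → μ.real E = ∑ π ∈ (canonSet k).filter Φ, μ.real (atom p π)`; variants `measureReal_eq_sum_atoms_ite`,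
  `PatternDetermined.measureReal_eq_sum`, `sum_measureReal_atom(_eq_one)`, `measureReal_openConn`.
* **`k = 5` made explicit**: the table `pat5 : Fin 52 → (Fin 5 → Fin 5)`, `image_pat5 : univ.image pat5 = canonSet 5`,
  `pat5_injective` (`decide +kernel`) and `measureReal_eq_sum_pat5(_ite)` — the decomposition as a sum over `Fin 52`.
Related tree material: `Theorems.PatternCells`/`CertCells` (crux `NoHeavyLowerTail`, stmt-4575) treat five terminals on `Fin n`
with cells indexed by 10-bit patterns; this file is the general-`k`, general-`V`, partition-labelled form for line `tieline`.
[folklore] (min-label / restricted-growth encoding of set partitions, e.g. Stanton–White, *Constructive Combinatorics*, 1986)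
-/

namespace Summit.CriticalPhenomena.PercolationContinuityZ3.Cruxes.AdditiveGluing.TieLine.ConnAtoms

open MeasureTheory Set Literature.Probability.Percolation
open Literature.Probability.LatticeModels (prodBernoulli)

/-! ### Canonical labelings of set partitions of `Fin k` -/

section Labelings

variable {k : ℕ}

/-- `π : Fin k → Fin k` is a **canonical labeling** (of the partition `i ~ j ⇔ π i = π j`): every label is a fixed point
lying below the labelled point — equivalently `π i` is the least element of the block of `i` (a decidable predicate with
parameters, not a statement). [folklore] -/
def IsCanon (π : Fin k → Fin k) : Prop := ∀ i, π (π i) = π i ∧ π i ≤ i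

/-- `IsCanon` is decidable (it is a finite conjunction of decidable statements). [folklore] -/
instance instDecidablePredIsCanon : DecidablePred (@IsCanon k) :=
  fun π => inferInstanceAs (Decidable (∀ i, π (π i) = π i ∧ π i ≤ i))

/-- The finite set of canonical labelings of `Fin k` (in bijection with the set partitions of `Fin k`). [folklore] -/
def canonSet (k : ℕ) : Finset (Fin k → Fin k) := Finset.univ.filter IsCanon

/-- Membership in `canonSet`. [folklore] -/
@[simp] theorem mem_canonSet {π : Fin k → Fin k} : π ∈ canonSet k ↔ IsCanon π := by simp [canonSet]

namespace IsCanon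

variable {π π' : Fin k → Fin k}

/-- Labels are fixed points. [folklore] -/
theorem apply_apply (h : IsCanon π) (i : Fin k) : π (π i) = π i := (h i).1

/-- The label of `i` is a lower bound of the block of `i`. [folklore] -/
theorem apply_le_of_eq (h : IsCanon π) {i j : Fin k} (hij : π j = π i) : π i ≤ j := hij ▸ (h j).2

/-- **Uniqueness**: two canonical labelings with the same blocks are equal. [folklore] -/
theorem eq_of_forall_iff (h : IsCanon π) (h' : IsCanon π') (H : ∀ i j, π i = π j ↔ π' i = π' j) : π = π' := by
  funext i
  refine le_antisymm ?_ ?_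
  · exact h.apply_le_of_eq ((H (π' i) i).2 (h'.apply_apply i))
  · exact h'.apply_le_of_eq ((H (π i) i).1 (h.apply_apply i))

end IsCanon

open scoped Classical in
/-- The canonical labeling of a relation `r` on `Fin k`: `canonOf r i = min ({i} ∪ {j | r i j})` (for an equivalence
relation, the least element of the class of `i`). [folklore] -/
noncomputable def canonOf (r : Fin k → Fin k → Prop) (i : Fin k) : Fin k :=
  (insert i (Finset.univ.filter fun j => r i j)).min' (Finset.insert_nonempty _ _)

variable (r : Fin k → Fin k → Prop)

/-- `canonOf r i ≤ i`. [folklore] -/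
theorem canonOf_le (i : Fin k) : canonOf r i ≤ i := Finset.min'_le _ _ (Finset.mem_insert_self _ _)

/-- `canonOf r i ≤ j` whenever `r i j`. [folklore] -/
theorem canonOf_le_of_rel {i j : Fin k} (h : r i j) : canonOf r i ≤ j := by
  classical
  exact Finset.min'_le _ _ (Finset.mem_insert_of_mem (Finset.mem_filter.2 ⟨Finset.mem_univ _, h⟩))

/-- For reflexive `r`, `r i (canonOf r i)`. [folklore] -/
theorem rel_canonOf (hr : ∀ i, r i i) (i : Fin k) : r i (canonOf r i) := by
  classical
  have h := Finset.min'_mem (insert i (Finset.univ.filter fun j => r i j)) (Finset.insert_nonempty _ _)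
  rcases Finset.mem_insert.1 h with h | h
  · rw [show canonOf r i = i from h]; exact hr i
  · exact (Finset.mem_filter.1 h).2

variable {r}

/-- For an equivalence relation, `canonOf r i = canonOf r j ↔ r i j`. [folklore] -/
theorem canonOf_eq_iff (hr : Equivalence r) {i j : Fin k} : canonOf r i = canonOf r j ↔ r i j := by
  constructor
  · intro h
    have hi := rel_canonOf r hr.refl i
    rw [h] at hi
    exact hr.trans hi (hr.symm (rel_canonOf r hr.refl j))
  · intro h
    exact le_antisymm (canonOf_le_of_rel r (hr.trans h (rel_canonOf r hr.refl j)))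
      (canonOf_le_of_rel r (hr.trans (hr.symm h) (rel_canonOf r hr.refl i)))

/-- For an equivalence relation, `canonOf r` is a canonical labeling. [folklore] -/
theorem isCanon_canonOf (hr : Equivalence r) : IsCanon (canonOf r) := fun i =>
  ⟨(canonOf_eq_iff hr).2 (hr.symm (rel_canonOf r hr.refl i)), canonOf_le r i⟩

/-- **Re-indexing a sum over `canonSet k` by an explicit enumeration** `e : Fin N → (Fin k → Fin k)` of the canonical
labelings (`univ.image e = canonSet k`, `e` injective). [folklore] -/
theorem sum_filter_canonSet_eq_of_enum {N : ℕ} {e : Fin N → Fin k → Fin k} (himg : Finset.univ.image e = canonSet k)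
    (hinj : Function.Injective e) {M : Type*} [AddCommMonoid M] (Φ : (Fin k → Fin k) → Prop) [DecidablePred Φ]
    (f : (Fin k → Fin k) → M) :
    ∑ π ∈ (canonSet k).filter Φ, f π = ∑ m ∈ Finset.univ.filter (fun m => Φ (e m)), f (e m) := by
  rw [← himg, Finset.filter_image, Finset.sum_image fun _ _ _ _ h => hinj h]

end Labelings

/-! ### Connectivity atoms -/

section Atoms

variable {V : Type*} {k : ℕ} (p : Fin k → V)

/-- The **connectivity atom** of pattern `π`: the configurations in which `p i ↔ p j` exactly when `π i = π j`. [folklore] -/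
def atom (π : Fin k → Fin k) : Set (BondConfig V) :=
  {ω | ∀ i j, (openGraph ω).Reachable (p i) (p j) ↔ π i = π j}

/-- Membership in an atom. [folklore] -/
@[simp] theorem mem_atom {π : Fin k → Fin k} {ω : BondConfig V} :
    ω ∈ atom p π ↔ ∀ i j, (openGraph ω).Reachable (p i) (p j) ↔ π i = π j := Iff.rfl

/-- Open connection between the marked vertices is an equivalence relation on the index set. [folklore] -/
theorem reachable_equivalence (ω : BondConfig V) : Equivalence fun i j : Fin k => (openGraph ω).Reachable (p i) (p j) :=
  ⟨fun _ => SimpleGraph.Reachable.refl _, fun h => h.symm, fun h h' => h.trans h'⟩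

/-- The **pattern** (canonical labeling of the connectivity partition) of the configuration `ω`:
`label p ω i = min {j | p i ↔ p j}`. [folklore] -/
noncomputable def label (ω : BondConfig V) : Fin k → Fin k :=
  canonOf fun i j => (openGraph ω).Reachable (p i) (p j)

/-- `label p ω` is canonical. [folklore] -/
theorem isCanon_label (ω : BondConfig V) : IsCanon (label p ω) := isCanon_canonOf (reachable_equivalence p ω)

/-- `label p ω i = label p ω j ↔ p i ↔ p j`. [folklore] -/
theorem label_eq_label_iff (ω : BondConfig V) {i j : Fin k} :
    label p ω i = label p ω j ↔ (openGraph ω).Reachable (p i) (p j) :=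
  canonOf_eq_iff (reachable_equivalence p ω)

/-- Every configuration lies in the atom of its pattern. [folklore] -/
theorem mem_atom_label (ω : BondConfig V) : ω ∈ atom p (label p ω) := fun _ _ => (label_eq_label_iff p ω).symm

/-- A configuration in the atom of a canonical `π` has pattern `π`. [folklore] -/
theorem label_eq_of_mem_atom {π : Fin k → Fin k} (hπ : IsCanon π) {ω : BondConfig V} (hω : ω ∈ atom p π) :
    label p ω = π :=
  (isCanon_label p ω).eq_of_forall_iff hπ fun i j => (label_eq_label_iff p ω).trans (hω i j)

/-- For canonical `π`: `ω ∈ atom p π ↔ label p ω = π`. [folklore] -/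
theorem mem_atom_iff_label_eq {π : Fin k → Fin k} (hπ : IsCanon π) {ω : BondConfig V} :
    ω ∈ atom p π ↔ label p ω = π :=
  ⟨label_eq_of_mem_atom p hπ, fun h => h ▸ mem_atom_label p ω⟩

/-- For canonical `π` the atom is the fibre of `label p` over `π`. [folklore] -/
theorem atom_eq_preimage_label {π : Fin k → Fin k} (hπ : IsCanon π) : atom p π = label p ⁻¹' {π} :=
  Set.ext fun _ => mem_atom_iff_label_eq p hπ

/-- Atoms of distinct canonical patterns are disjoint. [folklore] -/
theorem disjoint_atom {π π' : Fin k → Fin k} (hπ : IsCanon π) (hπ' : IsCanon π') (hne : π ≠ π') :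
    Disjoint (atom p π) (atom p π') :=
  Set.disjoint_left.2 fun _ h h' => hne ((label_eq_of_mem_atom p hπ h).symm.trans (label_eq_of_mem_atom p hπ' h'))

/-- The atoms indexed by a set of canonical patterns are pairwise disjoint. [folklore] -/
theorem pairwiseDisjoint_atom (s : Finset (Fin k → Fin k)) (hs : ∀ π ∈ s, IsCanon π) :
    (↑s : Set (Fin k → Fin k)).PairwiseDisjoint (atom p) :=
  fun _ hπ _ hπ' hne => disjoint_atom p (hs _ hπ) (hs _ hπ') hne

/-- The atoms of the canonical patterns cover the configuration space. [folklore] -/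
theorem iUnion_atom_eq_univ : ⋃ π ∈ canonSet k, atom p π = (univ : Set (BondConfig V)) :=
  Set.eq_univ_of_forall fun ω => Set.mem_iUnion₂.2 ⟨label p ω, mem_canonSet.2 (isCanon_label p ω), mem_atom_label p ω⟩

/-! ### Pattern-determined events -/

/-- `HasPattern p E Φ`: on the atom of every canonical pattern `π`, membership in `E` is the truth value `Φ π`
("`E` is the union of the atoms with `Φ`"; a predicate with parameters, not a statement). [folklore] -/
def HasPattern (E : Set (BondConfig V)) (Φ : (Fin k → Fin k) → Prop) : Prop :=
  ∀ ⦃π : Fin k → Fin k⦄, IsCanon π → ∀ ⦃ω : BondConfig V⦄, ω ∈ atom p π → (ω ∈ E ↔ Φ π)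

/-- `PatternDetermined p E`: membership in `E` depends on `ω` only through the connectivity pattern of the marked
vertices (a predicate with parameters, not a statement). [folklore] -/
def PatternDetermined (E : Set (BondConfig V)) : Prop :=
  ∀ ⦃ω ω' : BondConfig V⦄,
    (∀ i j, (openGraph ω).Reachable (p i) (p j) ↔ (openGraph ω').Reachable (p i) (p j)) → (ω ∈ E ↔ ω' ∈ E)

namespace HasPattern

variable {p} {E F : Set (BondConfig V)} {Φ Ψ : (Fin k → Fin k) → Prop}

/-- `{p i ↔ p j}` has pattern `π i = π j`. [folklore] -/
protected theorem openConn (p : Fin k → V) (i j : Fin k) :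
    HasPattern p (openConn (p i) (p j)) fun π => π i = π j :=
  fun _ _ _ hω => hω i j

/-- `{x ↔ y}` has pattern `π i = π j` when `x = p i`, `y = p j`. [folklore] -/
theorem openConn_of_eq {i j : Fin k} {x y : V} (hx : p i = x) (hy : p j = y) :
    HasPattern p (openConn x y) fun π => π i = π j := by
  subst hx hy
  exact HasPattern.openConn p i j

/-- The sure event has pattern `True`. [folklore] -/
protected theorem univ : HasPattern p (univ : Set (BondConfig V)) fun _ => True :=
  fun _ _ _ _ => iff_of_true (mem_univ _) trivial

/-- Complements: pattern `¬ Φ`. [folklore] -/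
protected theorem compl (h : HasPattern p E Φ) : HasPattern p Eᶜ fun π => ¬ Φ π :=
  fun _ hπ _ hω => (h hπ hω).not

/-- Intersections: pattern `Φ ∧ Ψ`. [folklore] -/
protected theorem inter (h : HasPattern p E Φ) (h' : HasPattern p F Ψ) : HasPattern p (E ∩ F) fun π => Φ π ∧ Ψ π :=
  fun _ hπ _ hω => (h hπ hω).and (h' hπ hω)

/-- Unions: pattern `Φ ∨ Ψ`. [folklore] -/
protected theorem union (h : HasPattern p E Φ) (h' : HasPattern p F Ψ) : HasPattern p (E ∪ F) fun π => Φ π ∨ Ψ π :=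
  fun _ hπ _ hω => (h hπ hω).or (h' hπ hω)

/-- Differences: pattern `Φ ∧ ¬ Ψ`. [folklore] -/
protected theorem diff (h : HasPattern p E Φ) (h' : HasPattern p F Ψ) : HasPattern p (E \ F) fun π => Φ π ∧ ¬ Ψ π :=
  fun _ hπ _ hω => (h hπ hω).and (h' hπ hω).not

/-- Indexed intersections: pattern `∀ t, Φ t`. [folklore] -/
protected theorem iInter {ι : Sort*} {E : ι → Set (BondConfig V)} {Φ : ι → (Fin k → Fin k) → Prop}
    (h : ∀ t, HasPattern p (E t) (Φ t)) : HasPattern p (⋂ t, E t) fun π => ∀ t, Φ t π :=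
  fun _ hπ _ hω => by rw [mem_iInter]; exact forall_congr' fun t => h t hπ hω

/-- Indexed unions: pattern `∃ t, Φ t`. [folklore] -/
protected theorem iUnion {ι : Sort*} {E : ι → Set (BondConfig V)} {Φ : ι → (Fin k → Fin k) → Prop}
    (h : ∀ t, HasPattern p (E t) (Φ t)) : HasPattern p (⋃ t, E t) fun π => ∃ t, Φ t π :=
  fun _ hπ _ hω => by rw [mem_iUnion]; exact exists_congr fun t => h t hπ hω

/-- An atom of a canonical pattern `π₀` has pattern `π = π₀`. [folklore] -/
protected theorem atom {π₀ : Fin k → Fin k} (h₀ : IsCanon π₀) : HasPattern p (atom p π₀) fun π => π = π₀ :=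
  fun _ hπ _ hω => by rw [mem_atom_iff_label_eq p h₀, label_eq_of_mem_atom p hπ hω]

/-- Changing the pattern predicate on canonical labelings. [folklore] -/
theorem of_iff (h : HasPattern p E Φ) (H : ∀ π, IsCanon π → (Φ π ↔ Ψ π)) : HasPattern p E Ψ :=
  fun _ hπ _ hω => (h hπ hω).trans (H _ hπ)

/-- **The event as a union of atoms**: `E = ⋃ {atom p π | π canonical, Φ π}`. [folklore] -/
theorem eq_biUnion [DecidablePred Φ] (h : HasPattern p E Φ) : E = ⋃ π ∈ (canonSet k).filter Φ, atom p π := by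
  ext ω
  simp only [mem_iUnion, Finset.mem_filter, mem_canonSet, exists_prop]
  exact ⟨fun hω => ⟨label p ω, ⟨isCanon_label p ω, (h (isCanon_label p ω) (mem_atom_label p ω)).1 hω⟩,
    mem_atom_label p ω⟩, fun ⟨_, ⟨hπ, hΦ⟩, hω⟩ => (h hπ hω).2 hΦ⟩

/-- **Pattern events are the preimages under `label p`**: `HasPattern p E Φ ↔ E = label p ⁻¹' {π | Φ π}`. [folklore] -/
theorem iff_eq_preimage : HasPattern p E Φ ↔ E = label p ⁻¹' {π | Φ π} :=
  ⟨fun h => Set.ext fun ω => h (isCanon_label p ω) (mem_atom_label p ω),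
    fun h _ hπ _ hω => by rw [h, mem_preimage, mem_setOf_eq, label_eq_of_mem_atom p hπ hω]⟩

/-- An event with a pattern is pattern-determined. [folklore] -/
theorem patternDetermined (h : HasPattern p E Φ) : PatternDetermined p E := by
  intro ω ω' H
  have hω' : ω' ∈ atom p (label p ω) := fun i j => (H i j).symm.trans (label_eq_label_iff p ω).symm
  exact (h (isCanon_label p ω) (mem_atom_label p ω)).trans (h (isCanon_label p ω) hω').symm

end HasPattern

namespace PatternDetermined

variable {p} {E F : Set (BondConfig V)}

/-- A pattern-determined event has the pattern `π ↦ (atom p π ⊆ E)`. [folklore] -/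
theorem hasPattern (h : PatternDetermined p E) : HasPattern p E fun π => atom p π ⊆ E :=
  fun _ _ _ hω => ⟨fun hE _ hω' => (h fun i j => (hω i j).trans (hω' i j).symm).1 hE, fun hsub => hsub hω⟩

/-- `{p i ↔ p j}` is pattern-determined. [folklore] -/
protected theorem openConn (p : Fin k → V) (i j : Fin k) : PatternDetermined p (openConn (p i) (p j)) :=
  (HasPattern.openConn p i j).patternDetermined

/-- Complements of pattern-determined events are pattern-determined. [folklore] -/
protected theorem compl (h : PatternDetermined p E) : PatternDetermined p Eᶜ := fun _ _ H => (h H).not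

/-- Intersections of pattern-determined events are pattern-determined. [folklore] -/
protected theorem inter (h : PatternDetermined p E) (h' : PatternDetermined p F) : PatternDetermined p (E ∩ F) :=
  fun _ _ H => (h H).and (h' H)

/-- Unions of pattern-determined events are pattern-determined. [folklore] -/
protected theorem union (h : PatternDetermined p E) (h' : PatternDetermined p F) : PatternDetermined p (E ∪ F) :=
  fun _ _ H => (h H).or (h' H)

end PatternDetermined

end Atoms

/-! ### The measure decomposition -/

section Measure

variable {V : Type*} [Finite V] {k : ℕ} (p : Fin k → V) (μ : Measure (BondConfig V)) [IsFiniteMeasure μ]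

/-- **Atom decomposition of a pattern event**: if on each atom membership in `E` is `Φ(pattern)`, then
`μ(E) = ∑_{π canonical, Φ π} μ(atom p π)` (finite `V`, finite measure `μ`, e.g. `μ = prodBernoulli w`). [folklore] -/
theorem measureReal_eq_sum_atoms {E : Set (BondConfig V)} {Φ : (Fin k → Fin k) → Prop} [DecidablePred Φ]
    (h : HasPattern p E Φ) : μ.real E = ∑ π ∈ (canonSet k).filter Φ, μ.real (atom p π) := by
  rw [h.eq_biUnion]
  exact measureReal_biUnion_finset
    (pairwiseDisjoint_atom p _ fun π hπ => mem_canonSet.1 (Finset.mem_filter.1 hπ).1)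
    fun _ _ => MeasurableSet.of_discrete

/-- The same decomposition with an indicator: `μ(E) = ∑_{π canonical} [Φ π] μ(atom p π)`. [folklore] -/
theorem measureReal_eq_sum_atoms_ite {E : Set (BondConfig V)} {Φ : (Fin k → Fin k) → Prop} [DecidablePred Φ]
    (h : HasPattern p E Φ) : μ.real E = ∑ π ∈ canonSet k, if Φ π then μ.real (atom p π) else 0 := by
  rw [measureReal_eq_sum_atoms p μ h, Finset.sum_filter]

open scoped Classical in
/-- **Atom decomposition of a pattern-determined event**: `μ(E) = ∑_{π canonical, atom p π ⊆ E} μ(atom p π)`. [folklore] -/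
theorem PatternDetermined.measureReal_eq_sum {E : Set (BondConfig V)} (h : PatternDetermined p E) :
    μ.real E = ∑ π ∈ canonSet k, if atom p π ⊆ E then μ.real (atom p π) else 0 :=
  measureReal_eq_sum_atoms_ite p μ h.hasPattern

/-- The atoms exhaust the mass: `∑_{π canonical} μ(atom p π) = μ(univ)`. [folklore] -/
theorem sum_measureReal_atom : ∑ π ∈ canonSet k, μ.real (atom p π) = μ.real univ := by
  rw [measureReal_eq_sum_atoms p μ HasPattern.univ, Finset.filter_true]

/-- For a probability measure the atom masses sum to `1`. [folklore] -/
theorem sum_measureReal_atom_eq_one [IsProbabilityMeasure μ] : ∑ π ∈ canonSet k, μ.real (atom p π) = 1 := by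
  rw [sum_measureReal_atom, probReal_univ]

/-- `μ(p i ↔ p j) = ∑_{π canonical, π i = π j} μ(atom p π)`. [folklore] -/
theorem measureReal_openConn (i j : Fin k) :
    μ.real (openConn (p i) (p j)) = ∑ π ∈ (canonSet k).filter (fun π => π i = π j), μ.real (atom p π) :=
  measureReal_eq_sum_atoms p μ (HasPattern.openConn p i j)

end Measure

/-! ### Five marked vertices: the explicit table of the 52 patterns -/

section Five

/-- The 52 canonical labelings of `Fin 5` (set partitions of five points), in lexicographic order. [folklore] -/
def pat5 : Fin 52 → Fin 5 → Fin 5 := ![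
  ![0, 0, 0, 0, 0], ![0, 0, 0, 0, 4], ![0, 0, 0, 3, 0], ![0, 0, 0, 3, 3], ![0, 0, 0, 3, 4],
  ![0, 0, 2, 0, 0], ![0, 0, 2, 0, 2], ![0, 0, 2, 0, 4], ![0, 0, 2, 2, 0], ![0, 0, 2, 2, 2],
  ![0, 0, 2, 2, 4], ![0, 0, 2, 3, 0], ![0, 0, 2, 3, 2], ![0, 0, 2, 3, 3], ![0, 0, 2, 3, 4],
  ![0, 1, 0, 0, 0], ![0, 1, 0, 0, 1], ![0, 1, 0, 0, 4], ![0, 1, 0, 1, 0], ![0, 1, 0, 1, 1],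
  ![0, 1, 0, 1, 4], ![0, 1, 0, 3, 0], ![0, 1, 0, 3, 1], ![0, 1, 0, 3, 3], ![0, 1, 0, 3, 4],
  ![0, 1, 1, 0, 0], ![0, 1, 1, 0, 1], ![0, 1, 1, 0, 4], ![0, 1, 1, 1, 0], ![0, 1, 1, 1, 1],
  ![0, 1, 1, 1, 4], ![0, 1, 1, 3, 0], ![0, 1, 1, 3, 1], ![0, 1, 1, 3, 3], ![0, 1, 1, 3, 4],
  ![0, 1, 2, 0, 0], ![0, 1, 2, 0, 1], ![0, 1, 2, 0, 2], ![0, 1, 2, 0, 4], ![0, 1, 2, 1, 0],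
  ![0, 1, 2, 1, 1], ![0, 1, 2, 1, 2], ![0, 1, 2, 1, 4], ![0, 1, 2, 2, 0], ![0, 1, 2, 2, 1],
  ![0, 1, 2, 2, 2], ![0, 1, 2, 2, 4], ![0, 1, 2, 3, 0], ![0, 1, 2, 3, 1], ![0, 1, 2, 3, 2],
  ![0, 1, 2, 3, 3], ![0, 1, 2, 3, 4]]

/-- The table `pat5` enumerates exactly the canonical labelings of `Fin 5` (kernel computation). [folklore] -/
theorem image_pat5 : Finset.univ.image pat5 = canonSet 5 := by decide +kernel

/-- The table `pat5` has no repetitions (kernel computation). [folklore] -/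
theorem pat5_injective : Function.Injective pat5 := by unfold Function.Injective; decide +kernel

/-- Sanity check: there are `B₅ = 52` connectivity patterns of five points. [folklore] -/
theorem card_canonSet_five : (canonSet 5).card = 52 := by
  rw [← image_pat5, Finset.card_image_of_injective _ pat5_injective, Finset.card_univ, Fintype.card_fin]

variable {V : Type*} [Finite V] (p : Fin 5 → V) (μ : Measure (BondConfig V)) [IsFiniteMeasure μ]

/-- **Five-point atom decomposition, explicitly indexed**: `μ(E) = ∑_{m < 52, Φ (pat5 m)} μ(atom p (pat5 m))`.  To expand:
`rw [this, show Finset.univ.filter _ = ({2, 8, …} : Finset (Fin 52)) from by decide +kernel]; simp [Finset.sum_insert]`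
(tested, < 1 s). [folklore] -/
theorem measureReal_eq_sum_pat5 {E : Set (BondConfig V)} {Φ : (Fin 5 → Fin 5) → Prop} [DecidablePred Φ]
    (h : HasPattern p E Φ) :
    μ.real E = ∑ m ∈ Finset.univ.filter (fun m => Φ (pat5 m)), μ.real (atom p (pat5 m)) := by
  rw [measureReal_eq_sum_atoms p μ h, sum_filter_canonSet_eq_of_enum image_pat5 pat5_injective]

/-- The same with an indicator over all of `Fin 52`; expands to an explicit sum of atom masses by
`simp (config := {decide := true}) only [Fin.sum_univ_succ, Fin.sum_univ_zero, ite_true, ite_false, add_zero, zero_add]`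
(tested, < 1 s). [folklore] -/
theorem measureReal_eq_sum_pat5_ite {E : Set (BondConfig V)} {Φ : (Fin 5 → Fin 5) → Prop} [DecidablePred Φ]
    (h : HasPattern p E Φ) : μ.real E = ∑ m : Fin 52, if Φ (pat5 m) then μ.real (atom p (pat5 m)) else 0 := by
  rw [measureReal_eq_sum_pat5 p μ h, Finset.sum_filter]

/-- Usage example (the shape certificate proofs use): for `μ = prodBernoulli w` on `Fin n` and five marked vertices,
`μ({p 0 ↔ p 4} ∩ {p 3 ↮ p 4}) = ∑_{π canonical, π 0 = π 4 ∧ π 3 ≠ π 4} μ(atom p π)`. [folklore] -/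
example (n : ℕ) (w : Sym2 (Fin n) → unitInterval) (p : Fin 5 → Fin n) :
    (prodBernoulli w).real (openConn (p 0) (p 4) ∩ (openConn (p 3) (p 4))ᶜ) =
      ∑ π ∈ (canonSet 5).filter (fun π => π 0 = π 4 ∧ π 3 ≠ π 4), (prodBernoulli w).real (atom p π) :=
  measureReal_eq_sum_atoms p _ ((HasPattern.openConn p 0 4).inter (HasPattern.openConn p 3 4).compl)

end Five

end Summit.CriticalPhenomena.PercolationContinuityZ3.Cruxes.AdditiveGluing.TieLine.ConnAtoms
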